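import Mathlib.Algebra.Field.ZMod
import Literature.Computability.AlgebraicComplexity.FlipGraphEquivariance
import Literature.Computability.AlgebraicComplexity.FlipGraph222IsolatedKM
import Literature.Computability.AlgebraicComplexity.SmallFormatRankLaderman
import HarnessLib

/-!
# Laderman's scheme is an isolated vertex of the `(3,3,3)`-flip graph over `ℤ₂` (KM 2023, §4)

Topic `Literature/Computability/AlgebraicComplexity`; companion of `FlipGraph222IsolatedKM.lean` (the
printed flip-isolated `⟨2,2,2⟩` scheme) over the flip-graph vocabulary of `FlipGraphConnectivity.lean`
(KM Def. 1 `Scheme`, Def. 4 `Flips`, Prop. 3 `Reduces`, Def. 8 `Adj`, `AdjLE`),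
`FlipGraphEquivariance.lean` (KM's group `G`, the orbit graph `flipGraphKM`) and Laderman's algorithm
`SmallFormatRankLaderman.lean` (`ladermanW/U/V`, `matMulTensor_three_eq_sum_laderman`, every
commutative ring). Source: M. Kauers, J. Moosbauer, *Flip Graphs for Matrix Multiplication*, ISSAC
2023 = arXiv:2212.01175 (KM), §4, the `(3,3,3)`-flip graph of rank at most `23` for `K = ℤ₂`:
"There are also components consisting of a single vertex. Laderman's scheme is such an example."
Everything here is PROVED (kernel evaluation over `ZMod 2` plus general lemmas); no named facts.

## Contents

* §1 Over the two-element field a non-zero rank-one tensor determines its three factors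
  (`triad_factors_eq_of_two`; over `ℤ₂` "proportional" is "equal").
* §2 A family of non-zero rank-one tensors over `ℤ₂` no two of which share a factor in any slot admits
  NO flip (Def. 4 needs two elements `A⊗B⊗Γ, A⊗B'⊗Γ'` with a common factor) and NO reduction (the
  construction of Prop. 3 needs `A^{(t)} = α_i A^{(i)}`, i.e. two elements with a common factor up to a
  non-zero scalar): `not_flips_fam`, `not_reduces_fam`; hence such a scheme has no out-neighbour in
  the flip graph (`not_adj_of_elts_eq_fam`), every in-neighbour has larger rank
  (`rank_lt_of_adj_of_elts_eq_fam`, reductions only; flips are reversible), so it is isolated in the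
  flip graph of rank at most its own rank (`not_adjLE_of_elts_eq_fam`), and the same holds for its
  ORBIT in KM's graph on `G`-orbits (`not_flipGraphKM_mk_of_elts_eq_fam`,
  `rank_lt_of_flipGraphKM_mk_of_elts_eq_fam`).
* §3 **Laderman's scheme reduced mod 2** (`LadermanZ2.scheme`, the `23` terms of
  `SmallFormatRankLaderman.lean` over `ZMod 2`): its terms are non-zero and pairwise share no factor
  (`LadermanZ2.triad_ne_zero`, `LadermanZ2.pairwise_ne`, kernel evaluation), it is irreducible in the
  sense of KM Def. 2 (`LadermanZ2.not_reducible`), and **it is an isolated vertex**: no flip and no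
  reduction applies (`LadermanZ2.not_adj`), nothing of rank `≤ 23` flips or reduces to it
  (`LadermanZ2.not_adjLE`), and its orbit is isolated in the `(3,3,3)`-flip graph of rank at most
  `23` on `G`-orbits (`LadermanZ2.not_flipGraphKM`, `LadermanZ2.rank_lt_of_flipGraphKM`) —
  `kauersMoosbauer2023_laderman_isolated`.
* §4 The same for **KM's printed flip-isolated `⟨2,2,2⟩` scheme** of `FlipGraph222IsolatedKM.lean`
  ("This scheme has no neighbors and thus forms a connected component of its own"), now at the level
  of the graph: `KM222Isolated.scheme` (rank `8`), `KM222Isolated.not_adj`, `KM222Isolated.not_adjLE`,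
  `KM222Isolated.not_flipGraphKM`, `KM222Isolated.rank_lt_of_flipGraphKM` —
  `kauersMoosbauer2023_222_isolated`.

HONEST FRAMING: finite kernel facts about Laderman's printed `23`-term scheme read over `ℤ₂` (and
KM's printed `8`-term `⟨2,2,2⟩` scheme over `ℤ₂`) and their consequences for KM's flip graph over
`ℤ₂`; nothing is claimed about other fields, other components, or the rank of `⟨3,3,3⟩`.

## References

* M. Kauers, J. Moosbauer, *Flip Graphs for Matrix Multiplication*, ISSAC 2023, 381–388,
  doi:10.1145/3597066.3597120, arXiv:2212.01175: §4 (the `(3,3,3)`-flip graph over `ℤ₂`,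
  "components consisting of a single vertex. Laderman's scheme is such an example"), Def. 2, Def. 4,
  Def. 8. [KauersMoosbauer2022FlipGraphs]
* J. D. Laderman, *A noncommutative algorithm for multiplying `3 × 3` matrices using `23`
  multiplications*, Bull. Amer. Math. Soc. 82 (1976) 126–128. [Laderman1976]
-/

namespace Literature.Computability.AlgebraicComplexity

open scoped BigOperators
open Multiset

namespace FlipGraph

/-! ## §1 Over `ℤ₂` a non-zero rank-one tensor determines its factors -/

section Two

variable {K : Type*} [Field K] {ι κ μ : Type*}

/-- A rank-one tensor with a zero factor vanishes. [folklore] -/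
private theorem triad_eq_zero_of_factor {a : ι → K} {b : κ → K} {c : μ → K}
    (h : a = 0 ∨ b = 0 ∨ c = 0) : triad a b c = 0 := by
  funext x y z
  rcases h with rfl | rfl | rfl <;> simp [triad_apply]

/-- A non-zero rank-one tensor has non-zero factors. [folklore] -/
private theorem factors_ne_zero' {a : ι → K} {b : κ → K} {c : μ → K} (h : triad a b c ≠ 0) :
    a ≠ 0 ∧ b ≠ 0 ∧ c ≠ 0 :=
  ⟨fun ha => h (triad_eq_zero_of_factor (Or.inl ha)),
    fun hb => h (triad_eq_zero_of_factor (Or.inr (Or.inl hb))),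
    fun hc => h (triad_eq_zero_of_factor (Or.inr (Or.inr hc)))⟩

/-- Over a field, a rank-one tensor with non-zero factors is non-zero. [folklore] -/
private theorem triad_ne_zero_of_factors {a : ι → K} {b : κ → K} {c : μ → K} (ha : a ≠ 0)
    (hb : b ≠ 0) (hc : c ≠ 0) : triad a b c ≠ 0 := by
  obtain ⟨x, hx⟩ := Function.ne_iff.mp ha
  obtain ⟨y, hy⟩ := Function.ne_iff.mp hb
  obtain ⟨z, hz⟩ := Function.ne_iff.mp hc
  intro h
  have h' := congrFun (congrFun (congrFun h x) y) z
  simp only [triad_apply, Pi.zero_apply] at h'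
  exact mul_ne_zero (mul_ne_zero hx hy) hz h'

/-- **Over the two-element field a non-zero rank-one tensor determines its factors:** if every scalar
is `0` or `1` and `a⊗b⊗c = a'⊗b'⊗c' ≠ 0` then `a = a'`, `b = b'`, `c = c'` (in general the factors
are determined up to scalars; over `ℤ₂` the only non-zero scalar is `1`). This is why, over `ℤ₂`,
"two elements `A⊗B⊗Γ`, `A⊗B'⊗Γ'` of `S`" (Def. 4) and "`A^{(t)} = α_i A^{(i)}`" (Prop. 3) are
statements about EQUAL factor matrices of the elements of `S`.
[cite: KauersMoosbauer2022FlipGraphs, Def. 1 and Def. 4 (rank-one tensors `A⊗B⊗Γ`; ground field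
`ℤ₂` in §4)] -/
theorem triad_factors_eq_of_two (hK : ∀ x : K, x = 0 ∨ x = 1) {a a' : ι → K} {b b' : κ → K}
    {c c' : μ → K} (h : triad a b c = triad a' b' c') (h0 : triad a b c ≠ 0) :
    a = a' ∧ b = b' ∧ c = c' := by
  obtain ⟨ha, hb, hc⟩ := factors_ne_zero' h0
  obtain ⟨x₀, hx₀⟩ := Function.ne_iff.mp ha
  obtain ⟨y₀, hy₀⟩ := Function.ne_iff.mp hb
  obtain ⟨z₀, hz₀⟩ := Function.ne_iff.mp hc
  have one_of : ∀ {x : K}, x ≠ 0 → x = 1 := fun {x} hx => (hK x).resolve_left hx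
  replace hx₀ : a x₀ = 1 := one_of hx₀
  replace hy₀ : b y₀ = 1 := one_of hy₀
  replace hz₀ : c z₀ = 1 := one_of hz₀
  have key : ∀ x y z, a x * b y * c z = a' x * b' y * c' z := fun x y z => by
    have e := congrFun (congrFun (congrFun h x) y) z
    simpa only [triad_apply] using e
  have h1 : a' x₀ * b' y₀ * c' z₀ = 1 := by rw [← key, hx₀, hy₀, hz₀, mul_one, mul_one]
  have ha' : a' x₀ = 1 :=
    one_of fun e => zero_ne_one (by rw [e, zero_mul, zero_mul] at h1; exact h1)
  have hb' : b' y₀ = 1 :=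
    one_of fun e => zero_ne_one (by rw [e, mul_zero, zero_mul] at h1; exact h1)
  have hc' : c' z₀ = 1 :=
    one_of fun e => zero_ne_one (by rw [e, mul_zero] at h1; exact h1)
  refine ⟨funext fun x => ?_, funext fun y => ?_, funext fun z => ?_⟩
  · simpa only [hy₀, hz₀, hb', hc', mul_one] using key x y₀ z₀
  · simpa only [hx₀, hz₀, ha', hc', one_mul, mul_one] using key x₀ y z₀
  · simpa only [hx₀, hy₀, ha', hb', one_mul] using key x₀ y₀ z

end Two

/-! ## §2 Families whose elements pairwise share no factor: no flips, no reductions (over `ℤ₂`) -/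

section Fam

variable {K : Type*} [Field K] {ι κ μ : Type*} {σ : Type*} [Fintype σ]

/-- The multiset of the elements `w s ⊗ u s ⊗ v s` of an indexed family (the scheme presented by the
family, KM Def. 1). [cite: KauersMoosbauer2022FlipGraphs, Def. 1] -/
def fam (w : σ → ι → K) (u : σ → κ → K) (v : σ → μ → K) : Multiset (ι → κ → μ → K) :=
  (Finset.univ : Finset σ).val.map fun s => triad (w s) (u s) (v s)

variable {w : σ → ι → K} {u : σ → κ → K} {v : σ → μ → K}

/-- The sum of the family's elements. [cite: KauersMoosbauer2022FlipGraphs, Def. 1] -/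
theorem sum_fam (w : σ → ι → K) (u : σ → κ → K) (v : σ → μ → K) :
    (fam w u v).sum = ∑ s, triad (w s) (u s) (v s) := rfl

/-- The number of elements of the family. [cite: KauersMoosbauer2022FlipGraphs, Def. 1 (rank)] -/
theorem card_fam (w : σ → ι → K) (u : σ → κ → K) (v : σ → μ → K) :
    card (fam w u v) = Fintype.card σ := by
  simp [fam]

/-- Elements of the family. [cite: KauersMoosbauer2022FlipGraphs, Def. 1] -/
theorem mem_fam {T : ι → κ → μ → K} : T ∈ fam w u v ↔ ∃ s, T = triad (w s) (u s) (v s) := by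
  simp only [fam, Multiset.mem_map, Finset.mem_val, Finset.mem_univ, true_and]
  exact ⟨fun ⟨s, hs⟩ => ⟨s, hs.symm⟩, fun ⟨s, hs⟩ => ⟨s, hs.symm⟩⟩

/-- `sw₁₂ (a⊗b⊗c) = b⊗a⊗c`. [folklore] -/
private theorem sw₁₂_triad' (a : ι → K) (b : κ → K) (c : μ → K) :
    sw₁₂ (triad a b c) = triad b a c := by
  funext x y z; simp only [sw₁₂, triad_apply]; ring

/-- `sw₂₃ (a⊗b⊗c) = a⊗c⊗b`. [folklore] -/
private theorem sw₂₃_triad' (a : ι → K) (b : κ → K) (c : μ → K) :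
    sw₂₃ (triad a b c) = triad a c b := by
  funext x y z; simp only [sw₂₃, triad_apply]; ring

/-- `sw₁₃ (a⊗b⊗c) = c⊗b⊗a`. [folklore] -/
private theorem sw₁₃_triad' (a : ι → K) (b : κ → K) (c : μ → K) :
    sw₁₃ (triad a b c) = triad c b a := by
  funext x y z; simp only [sw₁₃, triad_apply]; ring

/-- `cyc (a⊗b⊗c) = b⊗c⊗a`. [folklore] -/
private theorem cyc_triad' (a : ι → K) (b : κ → K) (c : μ → K) :
    cyc (triad a b c) = triad b c a := by
  funext x y z; simp only [cyc, triad_apply]; ring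

/-- `cyc₂ (a⊗b⊗c) = c⊗a⊗b`. [folklore] -/
private theorem cyc₂_triad' (a : ι → K) (b : κ → K) (c : μ → K) :
    cyc₂ (triad a b c) = triad c a b := by
  funext x y z; simp only [cyc₂, triad_apply]; ring

/-- The family with the slots `(1 2)` exchanged. [folklore] -/
private theorem fam_map_sw₁₂ (w : σ → ι → K) (u : σ → κ → K) (v : σ → μ → K) :
    (fam w u v).map sw₁₂ = fam u w v := by
  simp only [fam, Multiset.map_map, Function.comp_def, sw₁₂_triad']

/-- The family with the slots `(2 3)` exchanged. [folklore] -/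
private theorem fam_map_sw₂₃ (w : σ → ι → K) (u : σ → κ → K) (v : σ → μ → K) :
    (fam w u v).map sw₂₃ = fam w v u := by
  simp only [fam, Multiset.map_map, Function.comp_def, sw₂₃_triad']

/-- The family with the slots `(1 3)` exchanged. [folklore] -/
private theorem fam_map_sw₁₃ (w : σ → ι → K) (u : σ → κ → K) (v : σ → μ → K) :
    (fam w u v).map sw₁₃ = fam v u w := by
  simp only [fam, Multiset.map_map, Function.comp_def, sw₁₃_triad']

/-- The family with the slots cyclically permuted. [folklore] -/
private theorem fam_map_cyc (w : σ → ι → K) (u : σ → κ → K) (v : σ → μ → K) :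
    (fam w u v).map cyc = fam u v w := by
  simp only [fam, Multiset.map_map, Function.comp_def, cyc_triad']

/-- The family with the slots cyclically permuted the other way. [folklore] -/
private theorem fam_map_cyc₂ (w : σ → ι → K) (u : σ → κ → K) (v : σ → μ → K) :
    (fam w u v).map cyc₂ = fam v w u := by
  simp only [fam, Multiset.map_map, Function.comp_def, cyc₂_triad']

/-- Over `ℤ₂`, a family of non-zero rank-one tensors with pairwise distinct first factors has no
repeated element. [folklore] -/
private theorem nodup_fam (hK : ∀ x : K, x = 0 ∨ x = 1) (h0 : ∀ s, triad (w s) (u s) (v s) ≠ 0)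
    (hw : ∀ i j, i ≠ j → w i ≠ w j) : (fam w u v).Nodup := by
  refine Multiset.Nodup.map (fun i j hij => ?_) Finset.univ.nodup
  by_contra hne
  exact hw i j hne (triad_factors_eq_of_two hK hij (h0 i)).1

/-- Two elements of such a family in different positions are `w i ⊗ u i ⊗ v i`, `w j ⊗ u j ⊗ v j` with
`i ≠ j`. [folklore] -/
private theorem two_positions (hK : ∀ x : K, x = 0 ∨ x = 1) (h0 : ∀ s, triad (w s) (u s) (v s) ≠ 0)
    (hw : ∀ i j, i ≠ j → w i ≠ w j) {T₁ T₂ : ι → κ → μ → K} {M : Multiset (ι → κ → μ → K)}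
    (hS : fam w u v = T₁ ::ₘ M) (hT₂ : T₂ ∈ M) :
    ∃ i j, i ≠ j ∧ T₁ = triad (w i) (u i) (v i) ∧ T₂ = triad (w j) (u j) (v j) := by
  have h₁ : T₁ ∈ fam w u v := by rw [hS]; exact Multiset.mem_cons_self _ _
  have h₂ : T₂ ∈ fam w u v := by rw [hS]; exact Multiset.mem_cons_of_mem hT₂
  have hnd := nodup_fam hK h0 hw
  rw [hS, Multiset.nodup_cons] at hnd
  have hne : T₂ ≠ T₁ := fun e => hnd.1 (e ▸ hT₂)
  obtain ⟨i, rfl⟩ := mem_fam.mp h₁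
  obtain ⟨j, rfl⟩ := mem_fam.mp h₂
  exact ⟨i, j, fun hij => hne (by rw [hij]), rfl, rfl⟩

/-- **No flip with the shared factor in the first slot** (Def. 4, the written case) applies to a
family of non-zero rank-one tensors over `ℤ₂` whose first factors are pairwise distinct.
[cite: KauersMoosbauer2022FlipGraphs, Def. 4 with §4 ("components consisting of a single vertex")] -/
theorem not_flipBase_fam (hK : ∀ x : K, x = 0 ∨ x = 1) (h0 : ∀ s, triad (w s) (u s) (v s) ≠ 0)
    (hw : ∀ i j, i ≠ j → w i ≠ w j) (S' : Multiset (ι → κ → μ → K)) :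
    ¬ FlipBase (fam w u v) S' := by
  rintro ⟨a, b, b', c, c', R, hS, -⟩
  obtain ⟨i, j, hij, hi, hj⟩ := two_positions hK h0 hw hS (Multiset.mem_cons_self _ _)
  have ei := (triad_factors_eq_of_two hK hi (ne_of_eq_of_ne hi (h0 i))).1
  have ej := (triad_factors_eq_of_two hK hj (ne_of_eq_of_ne hj (h0 j))).1
  exact hw i j hij (ei.symm.trans ej)

/-- **No reduction in the written case** (Prop. 3's construction: `A^{(t)} = α_i A^{(i)}` for the
modified elements, `B^{(t)} = Σ β_i B^{(i)}`) applies to a family of non-zero rank-one tensors over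
`ℤ₂` whose first factors are pairwise distinct: a modified element would share its first factor with
the removed one, and with no modified element `B^{(t)} = 0`.
[cite: KauersMoosbauer2022FlipGraphs, Prop. 3 and Def. 2 with §4 ("components consisting of a
single vertex")] -/
theorem not_redBase_fam (hK : ∀ x : K, x = 0 ∨ x = 1) (h0 : ∀ s, triad (w s) (u s) (v s) ≠ 0)
    (hw : ∀ i j, i ≠ j → w i ≠ w j) (S' : Multiset (ι → κ → μ → K)) :
    ¬ RedBase (fam w u v) S' := by
  rintro ⟨a₀, b₀, c₀, R, L, L₀, hS, hA, hB, -, -⟩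
  rcases Multiset.empty_or_exists_mem (L + L₀) with hL | ⟨q, hq⟩
  · -- no modified element: `B^{(t)} = 0`, so the removed element would be `0`
    have hT₀ : triad a₀ b₀ c₀ ∈ fam w u v := by rw [hS]; exact Multiset.mem_cons_self _ _
    obtain ⟨i, hi⟩ := mem_fam.mp hT₀
    rw [hL, Multiset.map_zero, Multiset.sum_zero] at hB
    exact h0 i (by rw [← hi, hB]; exact triad_eq_zero_of_factor (Or.inr (Or.inl rfl)))
  · -- a modified element `A_q ⊗ B_q ⊗ Γ_q` with `A₀ = α • A_q`: two positions, equal first factors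
    have hmem : tr q.1 ∈ (L + L₀).map (fun q => tr q.1) + R :=
      Multiset.mem_add.mpr (Or.inl (Multiset.mem_map_of_mem _ hq))
    obtain ⟨i, j, hij, hi, hj⟩ := two_positions hK h0 hw hS hmem
    have ei := (triad_factors_eq_of_two hK hi (ne_of_eq_of_ne hi (h0 i))).1
    have ej := (triad_factors_eq_of_two hK hj (ne_of_eq_of_ne hj (h0 j))).1
    have hwi : w i ≠ 0 := (factors_ne_zero' (h0 i)).1
    have hα : q.2.1 ≠ 0 := by
      intro h
      apply hwi
      rw [← ei, hA q hq, h, zero_smul]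
    have hα1 : q.2.1 = 1 := (hK _).resolve_left hα
    apply hw i j hij
    rw [← ei, hA q hq, hα1, one_smul, ej]

omit [Fintype σ] in
/-- Non-vanishing of the family's elements is a property of the factors, hence stable under slot
permutations. [folklore] -/
private theorem ne_zero_perm (h0 : ∀ s, triad (w s) (u s) (v s) ≠ 0) :
    (∀ s, triad (u s) (w s) (v s) ≠ 0) ∧ (∀ s, triad (w s) (v s) (u s) ≠ 0) ∧
      (∀ s, triad (v s) (u s) (w s) ≠ 0) ∧ (∀ s, triad (u s) (v s) (w s) ≠ 0) ∧
      (∀ s, triad (v s) (w s) (u s) ≠ 0) := by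
  have h := fun s => factors_ne_zero' (h0 s)
  exact ⟨fun s => triad_ne_zero_of_factors (h s).2.1 (h s).1 (h s).2.2,
    fun s => triad_ne_zero_of_factors (h s).1 (h s).2.2 (h s).2.1,
    fun s => triad_ne_zero_of_factors (h s).2.2 (h s).2.1 (h s).1,
    fun s => triad_ne_zero_of_factors (h s).2.1 (h s).2.2 (h s).1,
    fun s => triad_ne_zero_of_factors (h s).2.2 (h s).1 (h s).2.1⟩

/-- **No flip applies** ("`S'` is a flip of `S`", Def. 4 in all three slots) to a family of non-zero
rank-one tensors over `ℤ₂` no two of which share a factor in any slot.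
[cite: KauersMoosbauer2022FlipGraphs, Def. 4 with §4 ("components consisting of a single vertex")] -/
theorem not_flips_fam (hK : ∀ x : K, x = 0 ∨ x = 1) (h0 : ∀ s, triad (w s) (u s) (v s) ≠ 0)
    (hne : ∀ i j, i ≠ j → w i ≠ w j ∧ u i ≠ u j ∧ v i ≠ v j) (S' : Multiset (ι → κ → μ → K)) :
    ¬ Flips (fam w u v) S' := by
  obtain ⟨h12, -, h13, -, -⟩ := ne_zero_perm h0
  rintro (h | h | h)
  · exact not_flipBase_fam hK h0 (fun i j hij => (hne i j hij).1) S' h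
  · rw [fam_map_sw₁₂] at h
    exact not_flipBase_fam hK h12 (fun i j hij => (hne i j hij).2.1) _ h
  · rw [fam_map_sw₁₃] at h
    exact not_flipBase_fam hK h13 (fun i j hij => (hne i j hij).2.2) _ h

/-- **No reduction applies** ("`S'` is a reduction of `S`", Prop. 3 in all six cases of Def. 2) to a
family of non-zero rank-one tensors over `ℤ₂` no two of which share a factor in any slot.
[cite: KauersMoosbauer2022FlipGraphs, Def. 2 and Prop. 3 with §4 ("components consisting of a
single vertex")] -/
theorem not_reduces_fam (hK : ∀ x : K, x = 0 ∨ x = 1) (h0 : ∀ s, triad (w s) (u s) (v s) ≠ 0)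
    (hne : ∀ i j, i ≠ j → w i ≠ w j ∧ u i ≠ u j ∧ v i ≠ v j) (S' : Multiset (ι → κ → μ → K)) :
    ¬ Reduces (fam w u v) S' := by
  obtain ⟨h12, h23, h13, hcyc, hcyc₂⟩ := ne_zero_perm h0
  have hw := fun i j hij => (hne i j hij).1
  have hu := fun i j hij => (hne i j hij).2.1
  have hv := fun i j hij => (hne i j hij).2.2
  rintro (h | h | h | h | h | h)
  · exact not_redBase_fam hK h0 hw S' h
  · rw [fam_map_sw₂₃] at h
    exact not_redBase_fam hK h23 hw _ h
  · rw [fam_map_sw₁₂] at h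
    exact not_redBase_fam hK h12 hu _ h
  · rw [fam_map_cyc] at h
    exact not_redBase_fam hK hcyc hu _ h
  · rw [fam_map_cyc₂] at h
    exact not_redBase_fam hK hcyc₂ hv _ h
  · rw [fam_map_sw₁₃] at h
    exact not_redBase_fam hK h13 hv _ h

variable {t : ι → κ → μ → K}

/-- **A scheme over `ℤ₂` no two of whose elements share a factor has no neighbour in the flip graph**
(Def. 8: neither a flip nor a reduction applies).
[cite: KauersMoosbauer2022FlipGraphs, §4 ("components consisting of a single vertex"), Def. 8] -/
theorem not_adj_of_elts_eq_fam (hK : ∀ x : K, x = 0 ∨ x = 1) (x : Scheme t)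
    (hx : x.elts = fam w u v) (h0 : ∀ s, triad (w s) (u s) (v s) ≠ 0)
    (hne : ∀ i j, i ≠ j → w i ≠ w j ∧ u i ≠ u j ∧ v i ≠ v j) (y : Scheme t) : ¬ Adj x y := by
  rintro (h | h)
  · exact not_flips_fam hK h0 hne y.elts (hx ▸ h)
  · exact not_reduces_fam hK h0 hne y.elts (hx ▸ h)

/-- … and every in-neighbour has larger rank (flips are reversible, so only reductions from a higher
level can lead to it). [cite: KauersMoosbauer2022FlipGraphs, §3 ("flips are reversible") and Def. 8
("a reduction always leads to a vertex belonging to a lower level")] -/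
theorem rank_lt_of_adj_of_elts_eq_fam (hK : ∀ x : K, x = 0 ∨ x = 1) (x : Scheme t)
    (hx : x.elts = fam w u v) (h0 : ∀ s, triad (w s) (u s) (v s) ≠ 0)
    (hne : ∀ i j, i ≠ j → w i ≠ w j ∧ u i ≠ u j ∧ v i ≠ v j) {y : Scheme t} (h : Adj y x) :
    x.rank < y.rank := by
  rcases h with h | h
  · exact absurd h.symm (not_flips_fam hK h0 hne y.elts ∘ fun h' => hx ▸ h')
  · exact h.card_lt

/-- **Hence the scheme is an isolated vertex of the flip graph of rank at most its rank** (KM Def. 8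
(2): the subgraph induced on the vertices of rank `≤ r`): no edge leaves it and none enters it.
[cite: KauersMoosbauer2022FlipGraphs, §4 ("components consisting of a single vertex"), Def. 8] -/
theorem not_adjLE_of_elts_eq_fam (hK : ∀ x : K, x = 0 ∨ x = 1) (x : Scheme t)
    (hx : x.elts = fam w u v) (h0 : ∀ s, triad (w s) (u s) (v s) ≠ 0)
    (hne : ∀ i j, i ≠ j → w i ≠ w j ∧ u i ≠ u j ∧ v i ≠ v j) (y : Scheme t) :
    ¬ AdjLE x.rank x y ∧ ¬ AdjLE x.rank y x :=
  ⟨fun h => not_adj_of_elts_eq_fam hK x hx h0 hne y h.2.2,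
    fun h => absurd h.1 (not_le.mpr (rank_lt_of_adj_of_elts_eq_fam hK x hx h0 hne h.2.2))⟩

end Fam

/-! ### The orbit of such a scheme in KM's graph on `G`-orbits (`⟨n,n,n⟩`) -/

section Orbit

variable {K : Type*} [Field K] {n : ℕ} {σ : Type*} [Fintype σ]
  {w u v : σ → (Fin n × Fin n) → K}

/-- **The orbit has no out-neighbour** in KM's flip graph on `G`-orbits (edges between orbits are
induced by edges between representatives, and are seen by every representative,
`flipGraphKM_mk_iff`). [cite: KauersMoosbauer2022FlipGraphs, §4 ("components consisting of a
single vertex"), Def. 8] -/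
theorem not_flipGraphKM_mk_of_elts_eq_fam (hK : ∀ x : K, x = 0 ∨ x = 1)
    (x : Scheme (matMulTensor K n n n)) (hx : x.elts = fam w u v)
    (h0 : ∀ s, triad (w s) (u s) (v s) ≠ 0)
    (hne : ∀ i j, i ≠ j → w i ≠ w j ∧ u i ≠ u j ∧ v i ≠ v j)
    (q : Quotient (orbitSetoidKM K n)) : ¬ flipGraphKM K n (Quotient.mk _ x) q := by
  induction q using Quotient.ind with
  | _ y =>
    rw [flipGraphKM_mk_iff]
    rintro ⟨y', -, hadj⟩
    exact not_adj_of_elts_eq_fam hK x hx h0 hne y' hadj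

/-- **Every in-neighbour orbit has larger rank**, so the orbit is an isolated vertex of the flip graph
of rank at most the scheme's rank (KM Def. 8 (2)).
[cite: KauersMoosbauer2022FlipGraphs, §4 ("components consisting of a single vertex"), Def. 8] -/
theorem rank_lt_of_flipGraphKM_mk_of_elts_eq_fam (hK : ∀ x : K, x = 0 ∨ x = 1)
    (x : Scheme (matMulTensor K n n n)) (hx : x.elts = fam w u v)
    (h0 : ∀ s, triad (w s) (u s) (v s) ≠ 0)
    (hne : ∀ i j, i ≠ j → w i ≠ w j ∧ u i ≠ u j ∧ v i ≠ v j)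
    {p : Quotient (orbitSetoidKM K n)} (h : flipGraphKM K n p (Quotient.mk _ x)) :
    ∃ y : Scheme (matMulTensor K n n n), p = Quotient.mk _ y ∧ x.rank < y.rank := by
  obtain ⟨x₀, y₀, hx₀, hy₀, hadj⟩ := h
  obtain ⟨φ, hφ, hxe⟩ : (orbitSetoidKM K n).r y₀ x := Quotient.exact hy₀
  -- move the edge `x₀ → y₀` by `φ`: `φ(x₀) → φ(y₀) = x`
  refine ⟨x₀.map φ, ?_, ?_⟩
  · rw [← hx₀]
    exact Quotient.sound ⟨φ, hφ, rfl⟩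
  · have hadj' : Adj (x₀.map φ) x := by rw [hxe]; exact hφ.map_adj hadj
    exact rank_lt_of_adj_of_elts_eq_fam hK x hx h0 hne hadj'

end Orbit

end FlipGraph

/-! ## §3 Laderman's scheme over `ℤ₂` -/

namespace LadermanZ2

open FlipGraph

/-- Every scalar of `ℤ₂` is `0` or `1`. [folklore] -/
private theorem zmod_two_eq : ∀ x : ZMod 2, x = 0 ∨ x = 1 := by decide

/-- Laderman's `23` output patterns read mod `2` (tree slot 1).
[cite: Laderman1976, pp. 127–128] -/
abbrev W : LadermanIndex → Fin 3 × Fin 3 → ZMod 2 := ladermanW (ZMod 2)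

/-- Laderman's `23` left forms read mod `2` (tree slot 2). [cite: Laderman1976, p. 127] -/
abbrev U : LadermanIndex → Fin 3 × Fin 3 → ZMod 2 := ladermanU (ZMod 2)

/-- Laderman's `23` right forms read mod `2` (tree slot 3). [cite: Laderman1976, p. 127] -/
abbrev V : LadermanIndex → Fin 3 × Fin 3 → ZMod 2 := ladermanV (ZMod 2)

/-- Every term of Laderman's scheme is non-zero mod `2` (a rank-one tensor, KM Def. 1); kernel
evaluation. [cite: KauersMoosbauer2022FlipGraphs, §4 (Laderman's scheme over `ℤ₂`), Def. 1] -/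
theorem triad_ne_zero : ∀ s : LadermanIndex, triad (W s) (U s) (V s) ≠ 0 := by
  have h : ∀ s : LadermanIndex, W s ≠ 0 ∧ U s ≠ 0 ∧ V s ≠ 0 := by decide
  intro s hs
  obtain ⟨hw, hu, hv⟩ := h s
  obtain ⟨x, hx⟩ := Function.ne_iff.mp hw
  obtain ⟨y, hy⟩ := Function.ne_iff.mp hu
  obtain ⟨z, hz⟩ := Function.ne_iff.mp hv
  have e := congrFun (congrFun (congrFun hs x) y) z
  simp only [triad_apply, Pi.zero_apply] at e
  exact mul_ne_zero (mul_ne_zero hx hy) hz e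

/-- **No two of Laderman's `23` terms share a factor mod `2`**, in any of the three slots (kernel
evaluation: `3 · 253` comparisons of `3 × 3` matrices over `ℤ₂`).
[cite: KauersMoosbauer2022FlipGraphs, §4 ("Laderman's scheme is such an example")] -/
theorem pairwise_ne : ∀ i j : LadermanIndex, i ≠ j → W i ≠ W j ∧ U i ≠ U j ∧ V i ≠ V j := by
  decide

/-- **Laderman's scheme over `ℤ₂`** as a vertex of the `(3,3,3)`-flip graph: the multiset of its
`23` terms `w_r ⊗ u_r ⊗ v_r` (KM Def. 1), summing to `⟨3,3,3⟩` over `ℤ₂`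
(`matMulTensor_three_eq_sum_laderman`).
[cite: KauersMoosbauer2022FlipGraphs, §4 (Laderman's scheme over `ℤ₂`), Def. 1] -/
def scheme : Scheme (matMulTensor (ZMod 2) 3 3 3) where
  elts := fam W U V
  ne_zero T hT := by
    obtain ⟨s, rfl⟩ := mem_fam.mp hT
    exact triad_ne_zero s
  exists_triad T hT := by
    obtain ⟨s, rfl⟩ := mem_fam.mp hT
    exact ⟨_, _, _, rfl⟩
  sum_eq := by rw [sum_fam]; exact (matMulTensor_three_eq_sum_laderman (ZMod 2)).symm

/-- Its elements. [cite: KauersMoosbauer2022FlipGraphs, §4, Def. 1] -/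
theorem scheme_elts : scheme.elts = fam W U V := rfl

/-- Its rank is `23`. [cite: KauersMoosbauer2022FlipGraphs, §4 ("schemes of rank 23, matching the
record set by Laderman")] -/
theorem rank_scheme : scheme.rank = 23 := by
  rw [Scheme.rank, scheme_elts, card_fam]
  rfl

/-- **Laderman's scheme is irreducible over `ℤ₂`** (KM Def. 2, all six cases): a reducible family
over `ℤ₂` has two members with an equal factor (`Reducible.exists_eq_factor_of_two`).
[cite: KauersMoosbauer2022FlipGraphs, §4 ("Laderman's scheme is such an example"), Def. 2] -/
theorem not_reducible : ¬ Reducible W U V := by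
  intro h
  obtain ⟨i, j, hne, hsh⟩ := h.exists_eq_factor_of_two zmod_two_eq triad_ne_zero
  obtain ⟨h₁, h₂, h₃⟩ := pairwise_ne i j hne
  rcases hsh with e | e | e
  · exact h₁ e
  · exact h₂ e
  · exact h₃ e

/-- **No flip and no reduction applies to Laderman's scheme over `ℤ₂`**: it has no out-neighbour in
the `(3,3,3)`-flip graph. [cite: KauersMoosbauer2022FlipGraphs, §4 ("There are also components
consisting of a single vertex. Laderman's scheme is such an example.")] -/
theorem not_adj (y : Scheme (matMulTensor (ZMod 2) 3 3 3)) : ¬ Adj scheme y :=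
  not_adj_of_elts_eq_fam zmod_two_eq scheme scheme_elts triad_ne_zero pairwise_ne y

/-- Anything that flips or reduces TO Laderman's scheme over `ℤ₂` has rank `> 23`.
[cite: KauersMoosbauer2022FlipGraphs, §4 (the flip graph "of rank at most 23"), Def. 8] -/
theorem rank_lt_of_adj {y : Scheme (matMulTensor (ZMod 2) 3 3 3)} (h : Adj y scheme) :
    23 < y.rank :=
  rank_scheme ▸ rank_lt_of_adj_of_elts_eq_fam zmod_two_eq scheme scheme_elts triad_ne_zero pairwise_ne h

/-- **Laderman's scheme is an isolated vertex of the `(3,3,3)`-flip graph of rank at most `23` over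
`ℤ₂`** (vertices = schemes): no edge leaves it, none enters it.
[cite: KauersMoosbauer2022FlipGraphs, §4 ("components consisting of a single vertex. Laderman's
scheme is such an example"), Def. 8] -/
theorem not_adjLE (y : Scheme (matMulTensor (ZMod 2) 3 3 3)) :
    ¬ AdjLE 23 scheme y ∧ ¬ AdjLE 23 y scheme :=
  rank_scheme ▸ not_adjLE_of_elts_eq_fam zmod_two_eq scheme scheme_elts triad_ne_zero pairwise_ne y

/-- **… and on KM's own vertex set (orbits under the symmetry group `G`): the orbit of Laderman's
scheme has no out-neighbour.** [cite: KauersMoosbauer2022FlipGraphs, §4 ("components consisting of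
a single vertex. Laderman's scheme is such an example"), Def. 8] -/
theorem not_flipGraphKM (q : Quotient (orbitSetoidKM (ZMod 2) 3)) :
    ¬ flipGraphKM (ZMod 2) 3 (Quotient.mk _ scheme) q :=
  not_flipGraphKM_mk_of_elts_eq_fam zmod_two_eq scheme scheme_elts triad_ne_zero pairwise_ne q

/-- … and every orbit with an edge INTO it has rank `> 23`, so the orbit is an isolated vertex of the
`(3,3,3)`-flip graph of rank at most `23` over `ℤ₂` — "There are also components consisting of a
single vertex. Laderman's scheme is such an example."
[cite: KauersMoosbauer2022FlipGraphs, §4, Def. 8] -/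
theorem rank_lt_of_flipGraphKM {p : Quotient (orbitSetoidKM (ZMod 2) 3)}
    (h : flipGraphKM (ZMod 2) 3 p (Quotient.mk _ scheme)) :
    ∃ y : Scheme (matMulTensor (ZMod 2) 3 3 3), p = Quotient.mk _ y ∧ 23 < y.rank :=
  rank_scheme ▸ rank_lt_of_flipGraphKM_mk_of_elts_eq_fam zmod_two_eq scheme scheme_elts
    triad_ne_zero pairwise_ne h

end LadermanZ2

/-- **KM §4, Laderman's component is a single vertex** (summary): in the `(3,3,3)`-flip graph over
`ℤ₂` with KM's vertices (orbits under `G`) and edges `E₁ ∪ E₂`, the orbit of Laderman's rank-`23`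
scheme has no out-edge, and every in-edge comes from an orbit of rank `> 23`; in particular it is a
connected component of the flip graph of rank at most `23` consisting of a single vertex.
[cite: KauersMoosbauer2022FlipGraphs, §4 ("There are also components consisting of a single vertex.
Laderman's scheme is such an example.")] -/
theorem kauersMoosbauer2023_laderman_isolated :
    (∀ q, ¬ FlipGraph.flipGraphKM (ZMod 2) 3 (Quotient.mk _ LadermanZ2.scheme) q) ∧
      ∀ p, FlipGraph.flipGraphKM (ZMod 2) 3 p (Quotient.mk _ LadermanZ2.scheme) →
        ∃ y : FlipGraph.Scheme (matMulTensor (ZMod 2) 3 3 3),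
          p = Quotient.mk _ y ∧ 23 < y.rank :=
  ⟨LadermanZ2.not_flipGraphKM, fun _ h => LadermanZ2.rank_lt_of_flipGraphKM h⟩


/-! ## §4 The printed flip-isolated `⟨2,2,2⟩` scheme of KM §4, at the level of the graph -/

namespace KM222Isolated

open FlipGraph

/-- Every scalar of `ℤ₂` is `0` or `1`. [folklore] -/
private theorem zmod_two_eq' : ∀ x : ZMod 2, x = 0 ∨ x = 1 := by decide

/-- **KM's printed flip-isolated rank-`8` scheme of `⟨2,2,2⟩` over `ℤ₂`** (`FlipGraph222IsolatedKM.lean`)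
as a vertex of the `(2,2,2)`-flip graph: the multiset of its eight terms (KM Def. 1).
[cite: KauersMoosbauer2022FlipGraphs, §4 (displayed isolated scheme), Def. 1] -/
def scheme : Scheme (matMulTensor (ZMod 2) 2 2 2) where
  elts := fam w u v
  ne_zero T hT := by
    obtain ⟨s, rfl⟩ := mem_fam.mp hT
    exact triad_ne_zero s
  exists_triad T hT := by
    obtain ⟨s, rfl⟩ := mem_fam.mp hT
    exact ⟨_, _, _, rfl⟩
  sum_eq := by rw [sum_fam]; exact sum_eq

/-- Its elements. [cite: KauersMoosbauer2022FlipGraphs, §4, Def. 1] -/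
theorem scheme_elts : scheme.elts = fam w u v := rfl

/-- Its rank is `8`. [cite: KauersMoosbauer2022FlipGraphs, §4 ("rank at most 8")] -/
theorem rank_scheme : scheme.rank = 8 := by
  rw [Scheme.rank, scheme_elts, card_fam]
  rfl

/-- **"This scheme has no neighbors"**: no flip and no reduction applies to it.
[cite: KauersMoosbauer2022FlipGraphs, §4 ("This scheme has no neighbors and thus forms a connected
component of its own.")] -/
theorem not_adj (y : Scheme (matMulTensor (ZMod 2) 2 2 2)) : ¬ Adj scheme y :=
  not_adj_of_elts_eq_fam zmod_two_eq' scheme scheme_elts triad_ne_zero pairwise_ne y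

/-- Anything that flips or reduces TO it has rank `> 8`.
[cite: KauersMoosbauer2022FlipGraphs, §4 ("the (2,2,2)-flip graph of rank at most 8"), Def. 8] -/
theorem rank_lt_of_adj {y : Scheme (matMulTensor (ZMod 2) 2 2 2)} (h : Adj y scheme) : 8 < y.rank :=
  rank_scheme ▸ rank_lt_of_adj_of_elts_eq_fam zmod_two_eq' scheme scheme_elts triad_ne_zero pairwise_ne h

/-- **"… and thus forms a connected component of its own"** in the `(2,2,2)`-flip graph of rank at most
`8` (vertices = schemes): no edge leaves it, none enters it.
[cite: KauersMoosbauer2022FlipGraphs, §4, Def. 8] -/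
theorem not_adjLE (y : Scheme (matMulTensor (ZMod 2) 2 2 2)) :
    ¬ AdjLE 8 scheme y ∧ ¬ AdjLE 8 y scheme :=
  rank_scheme ▸ not_adjLE_of_elts_eq_fam zmod_two_eq' scheme scheme_elts triad_ne_zero pairwise_ne y

/-- … and on KM's vertex set (orbits under `G`): the orbit has no out-neighbour.
[cite: KauersMoosbauer2022FlipGraphs, §4, Def. 8] -/
theorem not_flipGraphKM (q : Quotient (orbitSetoidKM (ZMod 2) 2)) :
    ¬ flipGraphKM (ZMod 2) 2 (Quotient.mk _ scheme) q :=
  not_flipGraphKM_mk_of_elts_eq_fam zmod_two_eq' scheme scheme_elts triad_ne_zero pairwise_ne q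

/-- … and every orbit with an edge into it has rank `> 8`. [cite: KauersMoosbauer2022FlipGraphs, §4, Def. 8] -/
theorem rank_lt_of_flipGraphKM {p : Quotient (orbitSetoidKM (ZMod 2) 2)}
    (h : flipGraphKM (ZMod 2) 2 p (Quotient.mk _ scheme)) :
    ∃ y : Scheme (matMulTensor (ZMod 2) 2 2 2), p = Quotient.mk _ y ∧ 8 < y.rank :=
  rank_scheme ▸ rank_lt_of_flipGraphKM_mk_of_elts_eq_fam zmod_two_eq' scheme scheme_elts
    triad_ne_zero pairwise_ne h

end KM222Isolated

/-- **KM §4, the printed `⟨2,2,2⟩` scheme "forms a connected component of its own"** (summary, KM's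
orbit vertex set): its orbit has no out-edge in the `(2,2,2)`-flip graph over `ℤ₂`, and every in-edge
comes from an orbit of rank `> 8`. [cite: KauersMoosbauer2022FlipGraphs, §4 ("This scheme has no
neighbors and thus forms a connected component of its own.")] -/
theorem kauersMoosbauer2023_222_isolated :
    (∀ q, ¬ FlipGraph.flipGraphKM (ZMod 2) 2 (Quotient.mk _ KM222Isolated.scheme) q) ∧
      ∀ p, FlipGraph.flipGraphKM (ZMod 2) 2 p (Quotient.mk _ KM222Isolated.scheme) →
        ∃ y : FlipGraph.Scheme (matMulTensor (ZMod 2) 2 2 2),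
          p = Quotient.mk _ y ∧ 8 < y.rank :=
  ⟨KM222Isolated.not_flipGraphKM, fun _ h => KM222Isolated.rank_lt_of_flipGraphKM h⟩

end Literature.Computability.AlgebraicComplexity
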